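/-
Copyright (c) 2026. All rights reserved.
Released under Apache 2.0 license as described in the file LICENSE.
Authors: HodgeCM publication cell (pub-hodgecm), GR lane, seat GR-2 (`pub-hodgecm-own-hyp34`).
-/
import Literature.NumberTheory.GelbartRogawski1991.Prop311PrintedCM
import Literature.NumberTheory.GelbartRogawski1991.Prop311PrintedMpLeg
import HarnessLib

-- build-lane note (ops-buildfix G11b-3 recipe): dependent telescopes of the CM dual-pair datum; elaborate sequentially.
set_option Elab.async false

/-!
# [GelbartRogawski1991, Prop. 3.1.1] AS PRINTED at CM data from a leg over the Darboux frame

Topic `NumberTheory/GelbartRogawski1991`; namespace `Literature.NumberTheory.GelbartRogawski1991.Prop311`.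
Proved lemmas only; nothing of [GelbartRogawski1991] is asserted; `Prop311AsPrinted` is untouched.

The CM specialisation of `Prop311PrintedMpLeg.printed_conclusion_of_darbouxLeg`: `L` a CM field, `F = L⁺`, `σ` the
complex conjugation, `δ = imagUnit L`; the premise "record at the dual-pair line datum" is DISCHARGED by
`GRConstruction.gru_shape` (`Prop311PrintedCM.compatibleSplitting_pairLineDatum_CM`), and the invertibility of the
frame's Gram matrix by non-degeneracy of `φ = Tr Φ` (`isUnit_det_cmLineGram_of_nondegenerate`).  Hence
**`printed_conclusion_CM_of_darbouxLeg`**: for CM printed data `(V, Φ, ρ, i)` (`Φ` skew-Hermitian sesquilinear, `φ`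
non-degenerate, `i` THE rational splitting) and a `Φ`-orthogonal frame `(b, f)` (which exists:
`Prop311SkewHermitianOrthogonalBasis.exists_orthogonal_basis_imaginary`), clauses (1) and (2) of Prop. 3.1.1 hold
verbatim as rendered in `Prop311AsPrinted` as soon as ONE input is supplied — a continuous homomorphism
`φ₁ : Mp_ψ(𝐀ⁿ × 𝐀ⁿ, std)ᶜᵒⁿᵗ →* Mp_𝐀(W)` from the smooth metaplectic group of the STANDARD form (the tree's
`Weil1964.adelicMpCont L⁺ (Fin n) 1`) to print's metaplectic group, lying over the explicit adelic Darboux frame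
`darbouxFrame b f e` (`adelicTraceForm_darbouxFrame`: a Darboux frame in the normalisation of
`Prop311AdelicCoordinates.exists_adelicDarboux`).

## References
* [GelbartRogawski1991] S. Gelbart, J. Rogawski, Invent. Math. 105 (1991) 445–472, §3.1 p. 454 L17–42, Prop. 3.1.1
  p. 455 L1–2.
* [Mok2014] C. P. Mok, Mem. AMS 235 (2015), §1 (unitary groups over CM fields).
-/

set_option autoImplicit false

noncomputable section

open NumberField
open scoped TensorProduct Matrix Kronecker
open Literature.NumberTheory.Automorphic
open Literature.NumberTheory.Automorphic.UnitaryGroup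
open Literature.RepresentationTheory.HeisenbergGroup
open Literature.NumberTheory.Weil1964

namespace Literature.NumberTheory.GelbartRogawski1991

namespace Prop311

open UnitaryDualPair

section CM

variable (L : Type) [Field L] [NumberField L] [IsCMField L]
variable {n : ℕ} (f : Fin n → ↥(maximalRealSubfield L))
variable (e : Fin n × Fin 1 ≃ Fin n) (he : ∀ k : Fin n, (e.symm k).1 = k)
-- `V` an `L`-space; its `L⁺`-structure is Mathlib's restriction (no separate binder).
variable (V : Type) [AddCommGroup V] [Module L V]
variable (b : Module.Basis (Fin n) L V) (Φ : V →ₗ[↥(maximalRealSubfield L)] V →ₗ[↥(maximalRealSubfield L)] L)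
variable {S : Type} [NormedAddCommGroup S] [InnerProductSpace ℂ S]
variable (ρ : Representation ℂ (AdelicHeisenberg (↥(maximalRealSubfield L)) L V Φ) S)
variable (i : ratSp (↥(maximalRealSubfield L)) L V Φ →* adelicMp (↥(maximalRealSubfield L)) L V Φ ρ)
variable (hi : IsRationalSplitting (↥(maximalRealSubfield L)) L V Φ ρ i)

/-- at CM printed data the Gram matrix `T = diag(-2 d fᵢ)` of a `Φ`-orthogonal frame is invertible as soon as
`φ = Tr Φ` is non-degenerate (`frame_ne_zero_of_nondegenerate`, `isUnit_det_cmLineGram`).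
[cite: GelbartRogawski1991, §3.1 p. 454 L17, L37–42] -/
theorem isUnit_det_cmLineGram_of_nondegenerate
    (hΦ₁ : ∀ (a : L) (x y : V), Φ (a • x) y = a * Φ x y)
    (hΦ₂ : ∀ (a : L) (x y : V), Φ x (a • y) = Φ x y * IsCMField.complexConj L a)
    (hb : ∀ i j, i ≠ j → Φ (b i) (b j) = 0)
    (hf : ∀ i, Φ (b i) (b i) = algebraMap (↥(maximalRealSubfield L)) L (f i) * imagUnit L)
    (hφ : (traceForm (↥(maximalRealSubfield L)) L V Φ).Nondegenerate) :
    IsUnit (symplecticGram (↥(maximalRealSubfield L)) (imagUnitSq L) f).det :=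
  isUnit_det_cmLineGram L f
    (frame_ne_zero_of_nondegenerate (↥(maximalRealSubfield L)) L (IsCMField.complexConj L) V b Φ f hΦ₁ hΦ₂ hb hf hφ)

include hi he in
/-- **[GelbartRogawski1991, Prop. 3.1.1] AS PRINTED AT CM DATA from a leg over the Darboux frame.**  `L` a CM field,
`F = L⁺`, `σ` = complex conjugation, `δ = imagUnit L`; printed data `(V, Φ, ρ, i)` with THE rational splitting `i`
(`hi!`), `φ = Tr Φ` non-degenerate, a `Φ`-orthogonal `L`-basis `b` with `Φ(bᵢ, bᵢ) = fᵢ δ`.  Then every continuous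
homomorphism `φ₁ : Mp_ψ(𝐀ⁿ × 𝐀ⁿ, std)ᶜᵒⁿᵗ →* Mp_𝐀(W)` over the Darboux frame `darbouxFrame b f e` yields clauses (1) and (2) of
Prop. 3.1.1 verbatim — the compatible splitting being `GRConstruction.gru_shape`'s, moved along the tree's relabelling
and the frame junction (`Prop311PrintedTransport`).
[cite: GelbartRogawski1991, §3.1 p. 454 L17–42; Prop. 3.1.1 p. 455 L1–2] -/
theorem printed_conclusion_CM_of_darbouxLeg
    (hΦ₁ : ∀ (a : L) (x y : V), Φ (a • x) y = a * Φ x y)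
    (hΦ₂ : ∀ (a : L) (x y : V), Φ x (a • y) = Φ x y * IsCMField.complexConj L a)
    (hb : ∀ i j, i ≠ j → Φ (b i) (b j) = 0)
    (hf : ∀ i, Φ (b i) (b i) = algebraMap (↥(maximalRealSubfield L)) L (f i) * imagUnit L)
    (hφ : (traceForm (↥(maximalRealSubfield L)) L V Φ).Nondegenerate)
    (hi! : ∀ i' : ratSp (↥(maximalRealSubfield L)) L V Φ →* adelicMp (↥(maximalRealSubfield L)) L V Φ ρ,
      IsRationalSplitting (↥(maximalRealSubfield L)) L V Φ ρ i' → i' = i)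
    (φ₁ : adelicMpCont (↥(maximalRealSubfield L)) (Fin n)
        (1 : Matrix (Fin n) (Fin n) (AdeleRing (𝓞 ↥(maximalRealSubfield L)) ↥(maximalRealSubfield L))) →*
      adelicMp (↥(maximalRealSubfield L)) L V Φ ρ) (hφ₁ : Continuous φ₁)
    (hproj₁ : ∀ (m₁ : adelicMpCont (↥(maximalRealSubfield L)) (Fin n)
          (1 : Matrix (Fin n) (Fin n) (AdeleRing (𝓞 ↥(maximalRealSubfield L)) ↥(maximalRealSubfield L))))
        (c : (Fin n → AdeleRing (𝓞 ↥(maximalRealSubfield L)) ↥(maximalRealSubfield L)) ×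
          (Fin n → AdeleRing (𝓞 ↥(maximalRealSubfield L)) ↥(maximalRealSubfield L))),
      ((proj (↥(maximalRealSubfield L)) L V Φ ρ (φ₁ m₁) : adelicSp (↥(maximalRealSubfield L)) L V Φ) :
            AdelicSpace (↥(maximalRealSubfield L)) V ≃ₗ[AdeleRing (𝓞 ↥(maximalRealSubfield L)) ↥(maximalRealSubfield L)]
              AdelicSpace (↥(maximalRealSubfield L)) V)
          (darbouxFrame (↥(maximalRealSubfield L)) L (IsCMField.complexConj L) (complexConj_imagUnit L)
            (imagUnit_ne_zero L) (imagUnit_mul_self L) V b f e (isUnit_det_cmLineGram_of_nondegenerate L f V b Φ hΦ₁ hΦ₂ hb hf hφ) c) =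
        darbouxFrame (↥(maximalRealSubfield L)) L (IsCMField.complexConj L) (complexConj_imagUnit L)
            (imagUnit_ne_zero L) (imagUnit_mul_self L) V b f e (isUnit_det_cmLineGram_of_nondegenerate L f V b Φ hΦ₁ hΦ₂ hb hf hφ)
          (((adelicMpCont.proj (↥(maximalRealSubfield L)) (Fin n)
                (1 : Matrix (Fin n) (Fin n) (AdeleRing (𝓞 ↥(maximalRealSubfield L)) ↥(maximalRealSubfield L))) m₁ :
              symplecticGroup (polar (adelicForm (↥(maximalRealSubfield L)) (Fin n)
                (1 : Matrix (Fin n) (Fin n) (AdeleRing (𝓞 ↥(maximalRealSubfield L)) ↥(maximalRealSubfield L)))))) :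
            ((Fin n → AdeleRing (𝓞 ↥(maximalRealSubfield L)) ↥(maximalRealSubfield L)) ×
                (Fin n → AdeleRing (𝓞 ↥(maximalRealSubfield L)) ↥(maximalRealSubfield L))) ≃ₗ[
                AdeleRing (𝓞 ↥(maximalRealSubfield L)) ↥(maximalRealSubfield L)]
              ((Fin n → AdeleRing (𝓞 ↥(maximalRealSubfield L)) ↥(maximalRealSubfield L)) ×
                (Fin n → AdeleRing (𝓞 ↥(maximalRealSubfield L)) ↥(maximalRealSubfield L)))) c)) :
    (∃ s : adelicUnitary (↥(maximalRealSubfield L)) L V Φ →* adelicMp (↥(maximalRealSubfield L)) L V Φ ρ,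
        ∀ g : adelicUnitary (↥(maximalRealSubfield L)) L V Φ,
          projEnd (↥(maximalRealSubfield L)) L V Φ ρ (s g) =
            ((g : AdelicSpace (↥(maximalRealSubfield L)) V ≃ₗ[AdeleRing (𝓞 ↥(maximalRealSubfield L)) ↥(maximalRealSubfield L)]
                AdelicSpace (↥(maximalRealSubfield L)) V) :
              AdelicSpace (↥(maximalRealSubfield L)) V →ₗ[AdeleRing (𝓞 ↥(maximalRealSubfield L)) ↥(maximalRealSubfield L)]
                AdelicSpace (↥(maximalRealSubfield L)) V)) ∧
      ∃ s : adelicUnitary (↥(maximalRealSubfield L)) L V Φ →* adelicMp (↥(maximalRealSubfield L)) L V Φ ρ,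
        Continuous s ∧
        (∀ g : adelicUnitary (↥(maximalRealSubfield L)) L V Φ,
          projEnd (↥(maximalRealSubfield L)) L V Φ ρ (s g) =
            ((g : AdelicSpace (↥(maximalRealSubfield L)) V ≃ₗ[AdeleRing (𝓞 ↥(maximalRealSubfield L)) ↥(maximalRealSubfield L)]
                AdelicSpace (↥(maximalRealSubfield L)) V) :
              AdelicSpace (↥(maximalRealSubfield L)) V →ₗ[AdeleRing (𝓞 ↥(maximalRealSubfield L)) ↥(maximalRealSubfield L)]
                AdelicSpace (↥(maximalRealSubfield L)) V)) ∧
        ∀ g : adelicUnitary (↥(maximalRealSubfield L)) L V Φ,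
          IsRationalPoint (↥(maximalRealSubfield L)) L V Φ
              (g : AdelicSpace (↥(maximalRealSubfield L)) V ≃ₗ[AdeleRing (𝓞 ↥(maximalRealSubfield L)) ↥(maximalRealSubfield L)]
                AdelicSpace (↥(maximalRealSubfield L)) V) →
            s g ∈ i.range :=
  printed_conclusion_CM L f e he V b Φ ρ i hi hΦ₁ hΦ₂ hb hf
    (frame_ne_zero_of_nondegenerate (↥(maximalRealSubfield L)) L (IsCMField.complexConj L) V b Φ f hΦ₁ hΦ₂ hb hf hφ) hi!
    (mpLeg (↥(maximalRealSubfield L)) L V Φ f e (isUnit_det_cmLineGram_of_nondegenerate L f V b Φ hΦ₁ hΦ₂ hb hf hφ) ρ φ₁)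
    (continuous_mpLeg (↥(maximalRealSubfield L)) L V Φ f e (isUnit_det_cmLineGram_of_nondegenerate L f V b Φ hΦ₁ hΦ₂ hb hf hφ) ρ φ₁ hφ₁)
    (mpLeg_proj (↥(maximalRealSubfield L)) L (IsCMField.complexConj L) (complexConj_imagUnit L) (imagUnit_ne_zero L)
      (imagUnit_mul_self L) V b Φ f e (isUnit_det_cmLineGram_of_nondegenerate L f V b Φ hΦ₁ hΦ₂ hb hf hφ) ρ φ₁ hproj₁)

end CM

end Prop311

end Literature.NumberTheory.GelbartRogawski1991

end
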